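import Summits.KontsevichZagierPeriods.Zeta5Search.Denom.TwoTaleP15TopWindowHolds
import Summits.KontsevichZagierPeriods.Zeta5Search.Denom.TwoTaleP15Prop3

/-!
# P15 partner: `IntegralTFlat` holds — the (bmiss)-free denominator theorem for `p̂_n`

Cell pub-zeta5, fam-denom (HONEST FRAMING: systematic search; no irrationality claim unless certified).
Statements about DENOMINATORS OF RATIONAL NUMBERS and one-hypothesis restatements of the CONDITIONAL
chain of `Denom/TwoTaleP15TopWindow`; nothing here concerns `ζ(5)`, and the conditional exponent below is
not a certified number (its hypothesis `DecayT 28.462` is OPEN).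

With both non-decay inputs of `Denom/TwoTaleP15TopWindow` now theorems —
`prop3T_holds : Prop3T` ([Zudilin2014ZetaTwo, Prop. 3] at the partner parameters, `Denom/TwoTaleP15Prop3`)
and `topWindowT_holds : TopWindowT` (THEOREM W, `Denom/TwoTaleP15TopWindowHolds`) — we record:

* `integralTFlat_holds : IntegralTFlat` (UNCONDITIONAL): there is `E : ℕ → ℕ`, `0 < E n ≤ e^{εn}`
  eventually for every `ε > 0` (here `E n = lcm(1,…,⌊√(26n)⌋)⁶`), with `E n · D₁₆ₙ D₁₅ₙ · p̂_n ∈ ℤ` for all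
  large `n`, where `p̂_n = formPT (aT n) (bT n)` is Zudilin's second-tale form at
  `â = (32n+2; 11n+1, 13n+1, 15n+1)`, `b̂ = (15n+2; 6n+1, 24n+2, 26n+2)`.  (Print has `D₂₂ₙ D₂₆ₙ p̂_n ∈ ℤ`.)
* `pCoincidence_eventually_of_decayT`: `DecayT c' → 31 − ivlRate 9 < c' → ∀ᶠ n, p_n = −p̂_n`.
* `zetaTwo_exponent_le_of_decayT`: `DecayT 28.462 → (μ(ζ(2)) ≤ 5.0499 ∧ μ(ζ(2)) ≤ 5.09541179)` —
  CONDITIONAL on the open decay input only.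
-/

namespace Summit.KontsevichZagierPeriods.Zeta5Search.Denom.TwoTaleP15IntegralTHolds

open Filter
open Literature.NumberTheory.Irrationality.Zudilin2014
open Literature.NumberTheory.Transcendental (zetaValue)
open Summit.KontsevichZagierPeriods.Zeta5Search.TwoTaleP15
open Summit.KontsevichZagierPeriods.Zeta5Search.Denom.TwoTaleP15Saving (ivlRate)
open Summit.KontsevichZagierPeriods.Zeta5Search.Denom.TwoTaleP15Coincidence (DecayT)
open Summit.KontsevichZagierPeriods.Zeta5Search.Denom.TwoTaleP15CoincidenceFlat (IntegralTFlat)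
open Summit.KontsevichZagierPeriods.Zeta5Search.Denom.TwoTaleP15TopWindow
open Summit.KontsevichZagierPeriods.Zeta5Search.Denom.TwoTaleP15Window (topWindowT_holds)
open Summit.KontsevichZagierPeriods.Zeta5Search.Denom.TwoTaleP15Prop3 (prop3T_holds)

/-- **`IntegralTFlat` holds** (UNCONDITIONAL; a statement about denominators of the rationals `p̂_n`):
`∃ E`, subexponential, with `E_n · D₁₆ₙ D₁₅ₙ · p̂_n ∈ ℤ` for all large `n` — from
`integralTFlat_of_prop3T_topWindowT`, `prop3T_holds` and `topWindowT_holds`. -/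
theorem integralTFlat_holds : IntegralTFlat :=
  integralTFlat_of_prop3T_topWindowT prop3T_holds topWindowT_holds

/-- **The ♭ coincidence from the decay input alone** (CONDITIONAL on `DecayT c'`, OPEN):
`DecayT c' → 31 − ivlRate 9 < c' → ∀ᶠ n, p_n = −p̂_n`. -/
theorem pCoincidence_eventually_of_decayT {c' : ℝ} (hDT : DecayT c') (hc' : 31 - ivlRate 9 < c') :
    ∀ᶠ n : ℕ in atTop, formP (aP15 n) (bP15 n) = -formPT (aT n) (bT n) :=
  pCoincidence_eventually_of_topWindowT hDT hc' prop3T_holds topWindowT_holds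

/-- **P15 measure from the decay input alone** (CONDITIONAL on `DecayT 28.462`, OPEN; NOT a claim
about `ζ(2)`): `DecayT 28.462 → μ(ζ(2)) ≤ 5.0499 ∧ μ(ζ(2)) ≤ 5.09541179`. -/
theorem zetaTwo_exponent_le_of_decayT (hDT : DecayT 28.462) :
    ExponentLE (zetaValue 2) 5.0499 ∧ zetaTwo_irrationalityExponent_le :=
  zetaTwo_exponent_le_of_topWindowT hDT prop3T_holds topWindowT_holds

end Summit.KontsevichZagierPeriods.Zeta5Search.Denom.TwoTaleP15IntegralTHolds
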